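import Summits.QuantumFields.QCD.Theorems.PauliWegnerSeaChiralOneScaleTrajectoryTransferAE

/-!
# Chirality transfer for general positive tuples with a degenerate pair (line `Sketch`, crux
`PauliWegnerSea.ChiralOneScaleTrajectory`, stmt-QuantumFields-17512)

`chiralityTransfer_ae_tuple`: the hypothesis-free transfer `chiralityTransfer_ae` with the bare-mass tuple freed —
the pin may sit at ANY positive renormalised tuple `m` with `m_f = m_g` for the pion pair `(f, g)` (e.g. the `2+1` tuple
`(m, m, M)` with a heavy third flavour at `N_f = 3`, as card one-point-pion-pin proposes to decouple the Wilson sign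
problem from the light pair): `∀ ε ∃ m (positive, m_f = m_g) ∀ C ∃ᶠ k ∃ S ≥ L_k ∃ n ≤ S, C e^{-ε a_k n} <
‖(∫ det D Σ|G_f|² dμ_W)/(∫ det D dμ_W)‖` implies `reg.IsChiralAtZero`.  Same proof (`pionCorr_eq_neg_signedQuotient`
holds for every tuple with `m_f = m_g`).  Folklore bookkeeping.
-/

noncomputable section

namespace Summit.QuantumFields.QCD.Cruxes.ChiralOneScaleTrajectory.GoldstoneWitness

open scoped BigOperators
open MeasureTheory Filter
open Literature.MathematicalPhysics.QuantumFieldTheory Literature.MathematicalPhysics.QuantumLattice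
  Literature.Probability.LatticeModels

/-- **Chirality transfer, general tuple with a degenerate pair.** -/
theorem chiralityTransfer_ae_tuple :
    ∀ (Nf : ℕ) (f g : Fin Nf), f ≠ g → ∀ reg : QCDRegularisation Nf, (∀ ε : ℝ, 0 < ε → ∃ m : Fin Nf → ℝ, (∀ fl, 0 < m fl) ∧ m f = m g ∧ ∀ C : ℝ, ∃ᶠ k in atTop, ∃ S : ℕ, reg.L k ≤ S ∧ ∃ n : ℕ, n ≤ S ∧ C * Real.exp (-(ε * (reg.a k * n))) < ‖(∫ U : GaugeConfig 4 (2 * S + 1) (Matrix.specialUnitaryGroup (Fin 3) ℂ), (diracMatrix U fun fl => reg.mcrit k + reg.a k * m fl / reg.Zm k).det * ((∑ a : Fin 3, ∑ i : Fin 4, ∑ b : Fin 3, ∑ j : Fin 4, ‖(diracMatrix U fun fl => reg.mcrit k + reg.a k * m fl / reg.Zm k)⁻¹ (quarkEquiv (f, (Torus.proj (2 * S + 1) 0, a, i))) (quarkEquiv (f, (Torus.proj (2 * S + 1) (Pi.single 0 (n : ℤ)), b, j)))‖ ^ (2 : ℕ) : ℝ) : ℂ) ∂(wilsonMeasure (fundamentalRep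 (Fin 3)) (reg.β k))) / (∫ U : GaugeConfig 4 (2 * S + 1) (Matrix.specialUnitaryGroup (Fin 3) ℂ), (diracMatrix U fun fl => reg.mcrit k + reg.a k * m fl / reg.Zm k).det ∂(wilsonMeasure (fundamentalRep (Fin 3)) (reg.β k)))‖) → reg.IsChiralAtZero := by
  intro Nf f g hfg reg hpin ε hε
  obtain ⟨m, hm, hmfg, hC⟩ := hpin ε hε
  refine ⟨m, hm, fun hgap => ?_⟩
  obtain ⟨C, hev⟩ := hgap 1 1 (pseudoscalarDensityObs Nf (Matrix.single g f (1 : ℂ)))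
    (pseudoscalarDensityObs Nf (Matrix.single f g (1 : ℂ)))
  obtain ⟨k, ⟨S, hS, n, hn, hlt⟩, hk⟩ := ((hC C).and_eventually hev).exists
  have hle := hk S hS n hn
  have hmq : (fun fl => (reg.scheme m 0 0).mq fl k) = fun fl => reg.mcrit k + reg.a k * m fl / reg.Zm k := by
    funext fl
    simp [QCDRegularisation.scheme_mq]
  have hmk : (fun fl => reg.mcrit k + reg.a k * m fl / reg.Zm k) f =
      (fun fl => reg.mcrit k + reg.a k * m fl / reg.Zm k) g := by
    simp only [hmfg]
  rw [hmq, pionCorr_eq_neg_signedQuotient _ _ hfg hmk n, norm_neg] at hle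
  exact (lt_irrefl _) (hlt.trans_le hle)

end Summit.QuantumFields.QCD.Cruxes.ChiralOneScaleTrajectory.GoldstoneWitness

end
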